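import Summits.BirchSwinnertonDyer.BirchSwinnertonDyer.Theorems.BiquadraticEisensteinDescentDeuringOfCore
import Literature.NumberTheory.EllipticCurves.HeckeLFunctionEqLSeriesOfLocalFactors
import Literature.NumberTheory.EllipticCurves.RankinSelbergBaseChangeBadPrimesProofs
import Literature.NumberTheory.EllipticCurves.RankinSelbergEulerProductHeckeRegroupProofs
import Literature.NumberTheory.EllipticCurves.QuadraticTwistFundamentalEulerProductProofs
import Literature.NumberTheory.EllipticCurves.RohrlichAnticyclotomicTwistsCMForms
import Literature.NumberTheory.LFunctions.KroneckerCharacterPrimitive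
import HarnessLib

set_option linter.dupNamespace false -- `Summit.BirchSwinnertonDyer.BirchSwinnertonDyer.Theorems.…` (summit = sub)
set_option autoImplicit false

/-!
# BED route, «Deuring-ψ lane»: the CORE of Deuring's theorem is stable under quadratic twists —
# `CORE(E) ⇒ CORE(E^{(D)})` for a fundamental discriminant `D` at whose primes `E` has good reduction

Route `BiquadraticEisensteinDescent` of `Summits/BirchSwinnertonDyer` (crux `EisensteinHeartFlatCMInertBadKPrime`,
stmt-BirchSwinnertonDyer-21341; cell `bsd-wall`, width seat `bsd-wall-cm-bed-w4` g17). THEOREMS ONLY. After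
`…DeuringOfCore` (`deuring_of_core`: the named fact `Deuring_exists_heckeCharacter_of_maximalCM` follows from its CORE
«∃ ψ of infinity type `(1,0)` with `L(s, ψ) = L(W, s)` on `re s > 3/2`», curve by curve), this file proves that the
core propagates from a curve `E` (CM by a maximal order, `K` its CM field) to its quadratic twists `E^{(D)}` by the
fundamental discriminants `D` whose prime divisors are good primes of `E` (hence unramified in `K`): the character of
the twist is `ψ_{E^{(D)}} = ψ_E · (ψ_{χ_D} ∘ N_{K/ℚ})`, `χ_D = (D/·)` the Kronecker character (Silverman, *AEC* X.5
Ex. 10.16 with *ATAEC* II Thm. 10.5: `a_p(E^{(D)}) = χ_D(p) a_p(E)`; `L(E^{(D)}, s) = L(s, ψ_E · χ_D∘N)`).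

* §1 bookkeeping: `χ_D(p)` as the tree's twisting sign; the conductor relation
  `𝟙_{p ∤ N(E^{(D)})} p = χ_D(p)² · 𝟙_{p ∤ N(E)} p` read off the Dirichlet coefficients
  (`LFunction_quadraticTwist_prime_pow_of_fundamental`, recursion `a_{p²} = a_p² − 𝟙 p`).
* §2 **`core_quadraticTwist_of_core`**: with `η = (ψ_{χ_D}).compRelNorm K` (finite order ⇒ type `(0,0)`;
  unramified with value `χ_D(p)^{f(w|p)}` above `p ∤ D`, `compRelNorm_ofDirichlet_valueAtUniformizer`; RAMIFIED above
  `p ∣ D` unramified in `K`, `not_isUnramifiedAt_compRelNorm_ofDirichlet`), the character `ψ_E · η` has type `(1,0)` and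
  satisfies the prime-by-prime hypotheses of `heckeLFunction_eq_LSeries_of_frobenius` for `E^{(D)}` — the values of
  `ψ_E` above the good primes being Deuring's clause (iv) FOR THE PINNED `ψ_E`
  (`DeuringShape.isUnramifiedAt_and_values_of_pinned_of_hasGoodReduction`) and its ramification above the bad primes
  `…DeuringOfCore.not_isUnramifiedAt_of_pinned_of_lFunction_eq_zero`.

With the `ℚ`-isogeny `E ∼ E^{(d_K)}` (tree `isIsogenous_quadraticTwist_cmFieldDiscr_holds`) and `L`-invariance under
isogeny, every curve with a given maximal CM `j ≠ 0, 1728` is reached from ONE (for `j = 8000`: two) base curve by such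
a twist; so the open content of the Deuring row `j` is the core AT THE BASE CURVE. Nothing about BSD is proved here.

References: [SilvermanAEC2009] X.2 Ex. 10.16, X.5 Cor. 5.4.1, C.16; [SilvermanATAEC1994] II Thm. 9.2, Thm. 10.5 (b);
[NeukirchANT1999] VII (6.9), (8.1); [CasselsFrohlichANT1967] VII §6.3; [MontgomeryVaughan2007] §9.3.
-/

noncomputable section

open scoped Classical ComplexConjugate NumberField NumberTheorySymbols
open Filter NumberField IsDedekindDomain WeierstrassCurve Rat.HeightOneSpectrum
  Literature.NumberTheory.GaloisRepresentations
  Literature.NumberTheory.LFunctions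
  Literature.NumberTheory.LFunctions.KroneckerCharacter
  Literature.NumberTheory.LFunctions.ChamizoJimenezUrroz2021
  Literature.NumberTheory.EllipticCurves
  Literature.NumberTheory.EllipticCurves.ModularForms
  Literature.NumberTheory.Automorphic
  Summit.BirchSwinnertonDyer.BirchSwinnertonDyer.Theorems.RamifiedSevenEllipticUnits
open Literature.Barriers.RiemannHypothesis (IsFundamentalDiscriminant)

namespace Summit.BirchSwinnertonDyer.BirchSwinnertonDyer.Theorems.BiquadraticEisensteinDescentDeuringOfCore

/-! ## §1 Bookkeeping: the twisting sign `χ_D(p)` and the conductor relation -/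

section Sign

/-- The tree's twisting sign of `LFunction_quadraticTwist_prime_pow_of_fundamental` at the prime `p`:
`(D/p)` for odd `p`; at `p = 2`: `0`, `1`, `−1` as `D` is even, `≡ 1`, `≡ 5 (mod 8)`. [cite: SilvermanAEC2009, X.2 Exercise 10.16] -/
theorem twistSign_eq_kroneckerChar {D : ℤ} (hD : IsFundamentalDiscriminant D) [NeZero D.natAbs] {p : ℕ}
    (hp : p.Prime) :
    (((if p = 2 then (if (2 : ℤ) ∣ D then 0 else if D % 8 = 1 then 1 else -1) else J(D | p)) : ℤ) : ℂ) =
      kroneckerChar D (p : ZMod D.natAbs) := by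
  obtain ⟨-, hodd, htwo⟩ := isKroneckerChar_kroneckerChar hD
  by_cases h2 : p = 2
  · subst h2
    rw [if_pos rfl, Nat.cast_ofNat, htwo]
    by_cases hev : (2 : ℤ) ∣ D
    · rw [if_pos hev]
      have h8 : D % 8 ≠ 1 ∧ D % 8 ≠ 5 := by omega
      rw [if_neg h8.1, if_neg h8.2, Int.cast_zero]
    · rw [if_neg hev]
      -- `D` odd and fundamental: `D ≡ 1 (mod 4)`, so `D % 8 ∈ {1, 5}`
      have h4 : D % 4 = 1 := by
        rcases hD with ⟨h1, -, -⟩ | ⟨h4, -, -⟩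
        · exact h1
        · exact absurd (dvd_trans ⟨2, by norm_num⟩ h4) hev
      by_cases h81 : D % 8 = 1
      · rw [if_pos h81, if_pos h81, Int.cast_one]
      · have h85 : D % 8 = 5 := by omega
        rw [if_neg h81, if_neg h81, if_pos h85, Int.cast_neg, Int.cast_one]
  · rw [if_neg h2, hodd p hp h2]

/-- `χ_D(p)` for `p ∣ D` vanishes (as the tree's twisting sign). [cite: MontgomeryVaughan2007, §9.3] -/
theorem twistSign_eq_zero_iff {D : ℤ} (hD : IsFundamentalDiscriminant D) {p : ℕ} (hp : p.Prime) :
    ((if p = 2 then (if (2 : ℤ) ∣ D then 0 else if D % 8 = 1 then 1 else -1) else J(D | p)) : ℤ) = 0 ↔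
      (p : ℤ) ∣ D := by
  by_cases h2 : p = 2
  · subst h2
    rw [if_pos rfl]
    by_cases hev : (2 : ℤ) ∣ D
    · simp [hev]
    · rw [if_neg hev]
      constructor
      · intro h
        by_cases h81 : D % 8 = 1
        · rw [if_pos h81] at h; exact absurd h one_ne_zero
        · rw [if_neg h81] at h; exact absurd h (by norm_num)
      · intro h; exact absurd h hev
  · rw [if_neg h2, jacobiSym.eq_zero_iff]
    have hD0 : D ≠ 0 := by
      rintro rfl
      rcases hD with ⟨h1, -, -⟩ | ⟨-, -, hsq⟩
      · norm_num at h1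
      · simp at hsq
    constructor
    · rintro ⟨-, hg⟩
      have : (Int.gcd D p : ℤ) ∣ (p : ℤ) := Int.gcd_dvd_right _ _
      have hdvd : Int.gcd D p ∣ p := by exact_mod_cast this
      rcases (Nat.dvd_prime hp).mp hdvd with h1 | hpp
      · exact absurd h1 hg
      · have : (Int.gcd D p : ℤ) ∣ D := Int.gcd_dvd_left _ _
        rw [hpp] at this; exact this
    · intro h
      refine ⟨hp.ne_zero, fun h1 ↦ ?_⟩
      have : (p : ℤ) ∣ Int.gcd D p := Int.dvd_coe_gcd h (dvd_refl _)
      rw [h1, Nat.cast_one] at this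
      exact hp.one_lt.ne' (by exact_mod_cast Int.eq_one_of_dvd_one (by positivity) this)

end Sign

/-! ## §2 The core propagates to quadratic twists -/

section Twist

variable {K : Type} [Field K] [NumberField K]

omit [NumberField K] in
/-- A prime of `𝓞 K` containing the rational prime `p` lies over `pℤ`. [cite: NeukirchANT1999, Ch. I §8 (8.1)] -/
theorem mem_primesOver_span_of_natCast_mem {p : ℕ} (hp : p.Prime) {w : HeightOneSpectrum (𝓞 K)}
    (hw : ((p : ℕ) : 𝓞 K) ∈ w.asIdeal) : w.asIdeal ∈ (Ideal.span {(p : ℤ)}).primesOver (𝓞 K) := by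
  haveI : Fact p.Prime := ⟨hp⟩
  refine ⟨w.isPrime, ?_⟩
  rw [Ideal.liesOver_iff]
  refine Ideal.IsMaximal.eq_of_le (Int.ideal_span_isMaximal_of_prime p) Ideal.IsPrime.ne_top' ?_
  rw [Ideal.span_singleton_le_iff_mem, Ideal.under_def, Ideal.mem_comap, algebraMap_int_eq, map_natCast]
  exact hw

/-- `(p^f).factorization p = f`. [folklore] -/
private theorem factorization_prime_pow {p : ℕ} (hp : p.Prime) (f : ℕ) : (p ^ f).factorization p = f := by
  rw [Nat.factorization_pow, Finsupp.smul_apply, hp.factorization_self, smul_eq_mul, mul_one]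

variable (E : WeierstrassCurve ℚ) [E.IsElliptic] [E.IsGloballyMinimal]

/-- **The core of Deuring's theorem passes to quadratic twists.** Let `E/ℚ` (globally minimal model) have CM by the
maximal order of `K` (`E.j ∈ maximalCMJInvariants`, `IsCMFieldOfJ K E.j`), and suppose SOME Hecke character `ψ_E` of
`K` of infinity type `(1, 0)` has `L(s, ψ_E) = L(E, s)` on `re s > 3/2`. Let `D` be a fundamental discriminant all of
whose prime divisors are primes of GOOD reduction of `E`. Then the twist `E^{(D)}` has the same property, with
`ψ = ψ_E · (ψ_{χ_D} ∘ N_{K/ℚ})`: prime by prime `a_p(E^{(D)}) = χ_D(p) a_p(E)` (Silverman *AEC* X Ex. 10.16), the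
values of `ψ_E` above the good primes are Deuring's (iv) for the pinned `ψ_E`, `(ψ_{χ_D} ∘ N)(ϖ_w) = χ_D(p)^{f(w|p)}`
above `p ∤ D` and `ψ_{χ_D} ∘ N` is ramified above `p ∣ D`; the glue is `heckeLFunction_eq_LSeries_of_frobenius`.
[cite: SilvermanAEC2009, X.2 Exercise 10.16 and App. C §16] [cite: SilvermanATAEC1994, Ch. II Thm. 10.5 (b) (p. 171–172)]
[cite: NeukirchANT1999, Ch. VII Prop. (6.9) and §8 (8.1)] -/
theorem core_quadraticTwist_of_core (hj : E.j ∈ maximalCMJInvariants) (hK : IsCMFieldOfJ K E.j)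
    (hcore : ∃ ψ : HeckeCharacter K, ψ.HasInfinityType (fun _ ↦ 1) (fun _ ↦ 0) ∧
      ∀ s : ℂ, 3 / 2 < s.re → heckeLFunction ψ s = E.LSeries s)
    {D : ℤ} (hD : IsFundamentalDiscriminant D)
    (hgoodD : ∀ (p : ℕ) [Fact p.Prime], (p : ℤ) ∣ D → E.HasGoodReductionAtPrime p)
    [(E.quadraticTwist (D : ℚ)).IsElliptic] :
    ∃ ψ : HeckeCharacter K, ψ.HasInfinityType (fun _ ↦ 1) (fun _ ↦ 0) ∧
      ∀ s : ℂ, 3 / 2 < s.re → heckeLFunction ψ s = (E.quadraticTwist (D : ℚ)).LSeries s := by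
  classical
  obtain ⟨ψE, hinf, hpin⟩ := hcore
  -- frame
  have hIQ : IsImaginaryQuadratic K := Deuring_exists_heckeCharacter_of_maximalCM.isImaginaryQuadratic hj hK
  haveI : IsTotallyComplex K := hIQ.2
  haveI : Algebra.IsQuadraticExtension ℚ K := ⟨hK.1⟩
  have hCM : E.HasCM := hasCM_of_j_mem_cmJInvariants E (maximalCMJInvariants_subset_cmJInvariants hj)
  obtain ⟨c, hc⟩ : ∃ c : K ≃ₐ[ℚ] K, c ≠ 1 := by
    by_contra! h
    have hcard := Rigidity.card_algEquiv_eq_two (K := K) hK.1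
    haveI : Unique (K ≃ₐ[ℚ] K) := ⟨⟨1⟩, fun a ↦ h a⟩
    rw [Nat.card_unique] at hcard
    norm_num at hcard
  have hD0 : D ≠ 0 := by
    rintro rfl
    rcases hD with ⟨h1, -, -⟩ | ⟨-, -, hsq⟩
    · norm_num at h1
    · simp at hsq
  haveI : NeZero D.natAbs := ⟨Int.natAbs_ne_zero.mpr hD0⟩
  set W' := E.quadraticTwist (D : ℚ) with hW'
  -- the character of the twist
  set θ : DirichletCharacter ℂ D.natAbs := kroneckerChar D with hθ
  have hprim : θ.IsPrimitive := isPrimitive_kroneckerChar hD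
  set η : HeckeCharacter K := (HeckeCharacter.ofDirichlet θ).compRelNorm K with hη
  have hηtype : η.HasInfinityType (fun _ ↦ 0) (fun _ ↦ 0) :=
    hasInfinityType_zero_of_isFiniteOrder
      (HeckeCharacter.IsFiniteOrder.compRelNorm K (HeckeCharacter.isFiniteOrder_ofDirichlet θ))
  set ψ : HeckeCharacter K := ψE * η with hψ
  have hψtype : ψ.HasInfinityType (fun _ ↦ 1) (fun _ ↦ 0) := by
    have h := hinf.mul' hηtype
    have e1 : ((fun _ ↦ (1 : ℤ)) + fun _ ↦ (0 : ℤ) : InfinitePlace K → ℤ) = fun _ ↦ 1 := by funext; simp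
    have e0 : ((fun _ ↦ (0 : ℤ)) + fun _ ↦ (0 : ℤ) : InfinitePlace K → ℤ) = fun _ ↦ 0 := by funext; simp
    rwa [e1, e0] at h
  refine ⟨ψ, hψtype, fun s hs ↦ ?_⟩
  have hψval : ∀ w : HeightOneSpectrum (𝓞 K),
      ψ.valueAtUniformizer w = ψE.valueAtUniformizer w * η.valueAtUniformizer w :=
    fun w ↦ HeckeCharacter.valueAtUniformizer_mul' ψE η w
  -- `E` is semistable at the primes of `D`
  have hss : ∀ v : HeightOneSpectrum (𝓞 ℚ), ((primesEquiv v : ℕ) : ℤ) ∣ D → E.IsSemistableAt v := by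
    intro v hv
    haveI := Fact.mk (primesEquiv v).2
    exact Or.inl ((hasGoodReductionAtPrime_iff_hasGoodReductionAt_ringOfIntegers v E).mp (hgoodD _ hv))
  -- per-prime bookkeeping: `a_p(W') = t a_p(E)`, `a_{p²}(W') = t² a_{p²}(E)`, `𝟙' p = t² 𝟙 p`
  have key : ∀ v : HeightOneSpectrum (𝓞 ℚ),
      let p : ℕ := primesEquiv v
      let t : ℤ := if p = 2 then (if (2 : ℤ) ∣ D then 0 else if D % 8 = 1 then 1 else -1) else J(D | p)
      W'.LFunction p = t * E.LFunction p ∧ W'.LFunction (p ^ 2) = t ^ 2 * E.LFunction (p ^ 2) ∧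
        ((if p ∣ W'.conductorNorm ℤ then 0 else (p : ℤ)) : ℤ) =
          t ^ 2 * (if p ∣ E.conductorNorm ℤ then 0 else (p : ℤ)) := by
    intro v p t
    have hp : p.Prime := (primesEquiv v).2
    have h1 := E.LFunction_quadraticTwist_prime_pow_of_fundamental hD hss hp 1
    have h2 := E.LFunction_quadraticTwist_prime_pow_of_fundamental hD hss hp 2
    simp only [pow_one] at h1
    refine ⟨h1, h2, ?_⟩
    have heW := E.LFunction_apply_prime_pow_add_two_of_prime hp 0
    have heW' := W'.LFunction_apply_prime_pow_add_two_of_prime hp 0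
    rw [zero_add, pow_one, pow_zero, W'.isMultiplicative_LFunction.map_one, mul_one] at heW'
    rw [zero_add, pow_one, pow_zero, E.isMultiplicative_LFunction.map_one, mul_one] at heW
    have e1 : ((if p ∣ W'.conductorNorm ℤ then 0 else ((p : ℕ) : ℤ)) : ℤ) =
        W'.LFunction p * W'.LFunction p - W'.LFunction (p ^ 2) := by rw [heW']; ring
    have e2 : ((if p ∣ E.conductorNorm ℤ then 0 else ((p : ℕ) : ℤ)) : ℤ) =
        E.LFunction p * E.LFunction p - E.LFunction (p ^ 2) := by rw [heW]; ring
    rw [e1, e2, h1, h2]; ring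
  refine heckeLFunction_eq_LSeries_of_frobenius (K := K) hK.1 hc hψtype W' ?_ ?_ hs
  · -- BAD primes of `W'`: `a_p = 0` and `ψ` ramified above `p`
    intro p hp hpN
    obtain ⟨v, rfl⟩ : ∃ v : HeightOneSpectrum (𝓞 ℚ), (primesEquiv v : ℕ) = p :=
      ⟨primesEquiv.symm ⟨p, hp⟩, by rw [Equiv.apply_symm_apply]⟩
    haveI hpF : Fact (Nat.Prime (primesEquiv v : ℕ)) := ⟨hp⟩
    obtain ⟨h1, -, he⟩ := key v
    set t : ℤ := if (primesEquiv v : ℕ) = 2 then (if (2 : ℤ) ∣ D then 0 else if D % 8 = 1 then 1 else -1)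
      else J(D | (primesEquiv v : ℕ)) with ht
    rw [if_pos hpN] at he
    by_cases hEN : (primesEquiv v : ℕ) ∣ E.conductorNorm ℤ
    · -- `p` bad for `E`: additive, `ψ_E` ramified above `p`, `η` unramified
      have hbadE : ¬ E.HasGoodReductionAtPrime (primesEquiv v : ℕ) :=
        (E.dvd_conductorNorm_iff_not_hasGoodReductionAtPrime _).mp hEN
      have hbadv : ¬ E.HasGoodReductionAt v := fun h ↦
        hbadE ((hasGoodReductionAtPrime_iff_hasGoodReductionAt_ringOfIntegers v E).mpr h)
      have hadd : E.HasAdditiveReductionAt v := hasAdditiveReductionAt_of_hasCM_of_bad E hCM v hbadv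
      have ha1 : E.LFunction (primesEquiv v : ℕ) = 0 :=
        E.LFunction_apply_eq_zero_of_hasAdditiveReductionAt (p := (primesEquiv v : ℕ)) (v := v) rfl hadd (dvd_refl _)
      have ha2 : E.LFunction ((primesEquiv v : ℕ) ^ 2) = 0 :=
        E.LFunction_apply_eq_zero_of_hasAdditiveReductionAt (p := (primesEquiv v : ℕ)) (v := v) rfl hadd
          (dvd_pow_self _ two_ne_zero)
      refine ⟨by rw [h1, ha1, mul_zero], fun w hw hψw ↦ ?_⟩
      have hEram := not_isUnramifiedAt_of_pinned_of_lFunction_eq_zero hK.1 hpin ha1 ha2 w hw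
      -- `p ∤ D` (else good), so `η` is unramified at `w`
      have hpD : ¬ (primesEquiv v : ℕ) ∣ D.natAbs := fun h ↦ hbadE (hgoodD _ (Int.natCast_dvd.mpr h))
      have hηunr := (compRelNorm_ofDirichlet_valueAtUniformizer K θ hp hpD
        (mem_primesOver_span_of_natCast_mem hp hw)).1
      apply hEram
      have := hψw.mul' hηunr.inv'
      rwa [hψ, mul_inv_cancel_right] at this
    · -- `p` good for `E`, so `t = 0`, `p ∣ D`: `η` ramified above `p`, `ψ_E` unramified
      rw [if_neg hEN] at he
      have ht0 : t = 0 := by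
        have : t ^ 2 = 0 := by
          have hp0 : ((primesEquiv v : ℕ) : ℤ) ≠ 0 := by exact_mod_cast hp.ne_zero
          have := he.symm
          rw [mul_comm] at this
          exact (mul_eq_zero.mp this).resolve_left hp0
        exact pow_eq_zero_iff two_ne_zero |>.mp this
      refine ⟨by rw [h1, ht0, zero_mul], fun w hw hψw ↦ ?_⟩
      have hpD : ((primesEquiv v : ℕ) : ℤ) ∣ D := (twistSign_eq_zero_iff hD hp).mp ht0
      have hgoodE : E.HasGoodReductionAtPrime (primesEquiv v : ℕ) := hgoodD _ hpD
      have hnd : ¬ ((primesEquiv v : ℕ) : ℤ) ∣ NumberField.discr K := not_dvd_discr_of_hasGoodReductionAtPrime E hj hK hgoodE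
      have hEunr : ψE.IsUnramifiedAt w :=
        DeuringShape.isUnramifiedAt_of_pinned_of_hasGoodReduction hK.1 hpin hgoodE hnd w hw
      have hKunr : Algebra.IsUnramifiedIn (𝓞 K) (Ideal.span {((primesEquiv v : ℕ) : ℤ)}) :=
        (NumberField.not_dvd_discr_iff_isUnramifiedIn K (𝓞 K) (Nat.prime_iff_prime_int.mp hp)).mp hnd
      have hηram := not_isUnramifiedAt_compRelNorm_ofDirichlet K hprim hp (Int.natCast_dvd.mp hpD) hKunr
        (mem_primesOver_span_of_natCast_mem hp hw)
      apply hηram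
      have := hEunr.inv'.mul' hψw
      rwa [hψ, inv_mul_cancel_left] at this
  · -- GOOD primes of `W'`
    intro p hp hpN w hw
    obtain ⟨v, rfl⟩ : ∃ v : HeightOneSpectrum (𝓞 ℚ), (primesEquiv v : ℕ) = p :=
      ⟨primesEquiv.symm ⟨p, hp⟩, by rw [Equiv.apply_symm_apply]⟩
    haveI hpF : Fact (Nat.Prime (primesEquiv v : ℕ)) := ⟨hp⟩
    obtain ⟨h1, -, he⟩ := key v
    set t : ℤ := if (primesEquiv v : ℕ) = 2 then (if (2 : ℤ) ∣ D then 0 else if D % 8 = 1 then 1 else -1)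
      else J(D | (primesEquiv v : ℕ)) with ht
    rw [if_neg hpN] at he
    have hp0 : ((primesEquiv v : ℕ) : ℤ) ≠ 0 := by exact_mod_cast hp.ne_zero
    have hEN : ¬ (primesEquiv v : ℕ) ∣ E.conductorNorm ℤ := by
      intro h; rw [if_pos h, mul_zero] at he; exact hp0 he
    rw [if_neg hEN] at he
    have ht2 : t ^ 2 = 1 := by
      have : ((primesEquiv v : ℕ) : ℤ) * (t ^ 2 - 1) = 0 := by linear_combination -he
      have := (mul_eq_zero.mp this).resolve_left hp0
      linear_combination this
    have ht2C : ((t : ℂ)) ^ 2 = 1 := by exact_mod_cast ht2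
    have hgoodE : E.HasGoodReductionAtPrime (primesEquiv v : ℕ) := by
      by_contra h
      exact hEN ((E.dvd_conductorNorm_iff_not_hasGoodReductionAtPrime _).mpr h)
    have hnd : ¬ ((primesEquiv v : ℕ) : ℤ) ∣ NumberField.discr K := not_dvd_discr_of_hasGoodReductionAtPrime E hj hK hgoodE
    have hpD : ¬ (primesEquiv v : ℕ) ∣ D.natAbs := by
      intro h
      have : t = 0 := (twistSign_eq_zero_iff hD hp).mpr (Int.natCast_dvd.mpr h)
      rw [this] at ht2; norm_num at ht2
    -- Deuring (iv) for the pinned `ψ_E` at `w`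
    obtain ⟨hEunr, hEsplit, hEinert⟩ :=
      DeuringShape.isUnramifiedAt_and_values_of_pinned_of_hasGoodReduction hK.1 c hc hpin hgoodE hnd w hw
    -- `η` at `w` and at `c • w`
    have hwv : w.under (𝓞 ℚ) = v := (under_eq_iff_natCast_primesEquiv_mem w v).mpr hw
    have hcw : (((primesEquiv v : ℕ) : ℕ) : 𝓞 K) ∈ (c • w).asIdeal :=
      (under_eq_iff_natCast_primesEquiv_mem (c • w) v).mp (by rw [HeightOneSpectrum.under_algEquiv_smul, hwv])
    obtain ⟨hηunr, hηval⟩ := compRelNorm_ofDirichlet_valueAtUniformizer K θ hp hpD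
      (mem_primesOver_span_of_natCast_mem hp hw)
    obtain ⟨hηunr', hηval'⟩ := compRelNorm_ofDirichlet_valueAtUniformizer K θ hp hpD
      (mem_primesOver_span_of_natCast_mem hp hcw)
    have htθ : (t : ℂ) = θ (primesEquiv v : ℕ) := by
      have := twistSign_eq_kroneckerChar hD hp (p := (primesEquiv v : ℕ))
      rw [← ht] at this
      exact this
    have hNw : Ideal.absNorm w.asIdeal = (primesEquiv v : ℕ) ^ w.asIdeal.inertiaDeg (𝓞 ℚ) := by
      rw [absNorm_asIdeal_eq_natGenerator_pow, hwv]; rfl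
    have hNcw : Ideal.absNorm (c • w).asIdeal = (primesEquiv v : ℕ) ^ w.asIdeal.inertiaDeg (𝓞 ℚ) := by
      rw [HeightOneSpectrum.absNorm_algEquiv_smul, hNw]
    rw [hNw, factorization_prime_pow hp] at hηval
    rw [hNcw, factorization_prime_pow hp] at hηval'
    -- frobenius trace and `a_p(W')`
    have haE : E.LFunction (primesEquiv v : ℕ) = E.frobeniusTrace (primesEquiv v : ℕ) :=
      LFunction_apply_prime_eq_frobeniusTrace E _ hgoodE
    -- `e(w|p) = 1`
    have he1 : w.asIdeal.ramificationIdx (𝓞 ℚ) = 1 := by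
      rcases placesOver_trichotomy_of_finrank_eq_two K hK.1 v with
        ⟨w₁, w₂, -, -, hall⟩ | ⟨w₀, hS, he1, -⟩ | ⟨w₀, hS, he2, -⟩
      · exact (hall w hwv).1
      · have : w = w₀ := by simpa using (show w ∈ ({w₀} : Set _) by rw [← hS]; exact hwv)
        subst this; exact he1
      · have : w = w₀ := by simpa using (show w ∈ ({w₀} : Set _) by rw [← hS]; exact hwv)
        subst this
        have h' : ((primesEquiv v : ℕ) : ℤ) ∣ NumberField.discr K := by
          have := natGenerator_dvd_discr_of_ramificationIdx_eq_two K w he2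
          rwa [hwv] at this
        exact absurd h' hnd
    refine ⟨hEunr.mul' hηunr, he1, fun hne ↦ ?_, fun heq ↦ ?_⟩
    · -- split: `f(w|p) = 1`
      have hf : w.asIdeal.inertiaDeg (𝓞 ℚ) = 1 :=
        (Literature.NumberTheory.NumberFields.ramificationIdx_eq_one_and_inertiaDeg_eq_one_of_smul_ne
          (K := ℚ) (L := K) hK.1 hc hwv hne).2
      rw [hf, pow_one] at hηval hηval'
      obtain ⟨hsum, hprod⟩ := hEsplit hne
      refine ⟨?_, ?_⟩
      · rw [hψval, hψval, hηval, hηval', ← htθ, ← add_mul, hsum, h1, haE]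
        push_cast; ring
      · rw [hψval, hψval, hηval, hηval', ← htθ]
        linear_combination (t : ℂ) ^ 2 * hprod + ((primesEquiv v : ℕ) : ℂ) * ht2C
    · -- inert: `f(w|p) = 2`
      have hf : w.asIdeal.inertiaDeg (𝓞 ℚ) = 2 := by
        have := Literature.NumberTheory.NumberFields.ramificationIdx_mul_inertiaDeg_eq_two_of_smul_eq
          (K := ℚ) (L := K) hK.1 hc hwv heq
        rw [he1, one_mul] at this
        exact this
      rw [hf] at hηval
      obtain ⟨ha0, hval⟩ := hEinert heq
      refine ⟨?_, ?_⟩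
      · rw [h1, haE, ha0, mul_zero]
      · rw [hψval, hηval, ← htθ, hval, ht2C, mul_one]

end Twist

end Summit.BirchSwinnertonDyer.BirchSwinnertonDyer.Theorems.BiquadraticEisensteinDescentDeuringOfCore
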